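import Literature.MathematicalPhysics.QuantumManyBody.GroundStateFeynmanKacOperatorProps
import Literature.MathematicalPhysics.QuantumManyBody.GroundStateFeynmanKacHeatKernel
import Literature.Analysis.FunctionSpaces.ContinuousKernelCompactOperator
import HarnessLib

/-!
# Ground-state Feynman–Kac: strong Feller property and compactness of `e^{-tH_N}` on `L²(Λ)`

Topic `Literature/MathematicalPhysics/QuantumManyBody`; theorems only. Step of the proof of the
named fact `Literature.MathematicalPhysics.QuantumManyBody.BoseGas.GroundStateFeynmanKac`
(Chung–Zhao (1995), Thm 3.17: for `t > 0`, `T_t` has the strong Feller property, maps `L²(D)`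
into `C_b(D)`, and is a compact operator on `L²(D)` when `m(D) < ∞`), for the box `D = Λ_L^N`
and a bounded measurable pair potential:

* `fkReal_equicontinuous` — **interior equicontinuity**: for `t > 0`, `X₀ ∈ Λ` and `ε > 0` there
  is `δ > 0` such that `|(e^{-tH} g)(X) - (e^{-tH} g)(X')| ≤ ε` for all `X, X' ∈ B(X₀, δ)` and ALL
  `g` with `‖g‖_{L²(Λ)} ≤ M` (semigroup law `e^{-tH} = e^{-sH} e^{-(t-s)H}` with `s` small, the
  `L² → L^∞` bound on `h = e^{-(t-s)H} g`, the weight defect `E[1 - w_s] ≤ P(τ ≤ s) + N²Cs` and the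
  exit bound of `GroundStateFeynmanKacHeatKernel`, and the translation continuity of the free heat
  kernel in `L¹`);
* `continuousAt_fkReal` — **strong Feller property**: `X ↦ (e^{-tH} g)(X)` is continuous on the
  open box for every `g ∈ L²(Λ)`;
* `continuousOn_fkKernelVec` — the Riesz vector `κ_t(X) ∈ L²(Λ)` of the evaluation functional
  `g ↦ (e^{-tH} g)(X)` (the kernel `u_t(X, ·)`) depends continuously on `X ∈ Λ` in `L²`;
* `isCompactOperator_fkL2` — **`e^{-tH_N}` is a compact operator on `L²(Λ_L^N)`** (`t > 0`): on
  each compact `K ⊂ Λ` the truncation `𝟙_K e^{-tH}` is compact by the tree's criterion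
  `Literature.Analysis.FunctionSpaces.isCompactOperator_of_ae_eq_indicator_inner`, and
  `‖e^{-tH} - 𝟙_K e^{-tH}‖ ≤ (4πt)^{-3N/4} |Λ ∖ K|^{1/2} → 0` along an exhaustion of the open box
  by closed sub-boxes.

## References

* K. L. Chung, Z. Zhao, *From Brownian Motion to Schrödinger's Equation* (1995), Thm 2.2,
  Prop 3.12, Thm 3.17. [ChungZhao1995]
* M. Reed, B. Simon, *Methods of Modern Mathematical Physics I* (1980), Thm VI.12.
-/

noncomputable section

namespace Literature.MathematicalPhysics.QuantumManyBody.BoseGas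

open MeasureTheory ProbabilityTheory Filter Set Metric
open scoped ENNReal NNReal Topology InnerProductSpace
open Literature.Probability.Process

variable {N : ℕ}

/-! ### Interior equicontinuity -/

/-- **Sup bound for `e^{-τH} g` in terms of the `L²(Λ)` mass, uniformly for `τ ≥ t₀ > 0`**:
`|(e^{-τH} g)(Y)| ≤ (4πt₀)^{-3N/4} M` if `‖g‖_{L²(Λ)} ≤ M`. [folklore] -/
theorem abs_fkReal_le_heatConst (v : ℝ → ℝ≥0∞) (L : ℝ) {t₀ τ : ℝ} (ht₀ : 0 < t₀) (hτ : t₀ ≤ τ)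
    {g : Config N → ℝ} (hg : Measurable g) {M : ℝ} (hM : 0 ≤ M)
    (hg2 : (∫⁻ Y in boxN N L, ‖g Y‖ₑ ^ (2 : ℝ)) ^ (1 / 2 : ℝ) ≤ ENNReal.ofReal M) (Y : Config N) :
    |fkReal v L τ g Y| ≤
      ((∏ _i : Fin N, ∏ _k : Fin 3,
        ENNReal.ofReal (Real.sqrt (2 * Real.pi * (2 * t₀.toNNReal)))⁻¹) ^ (1 / 2 : ℝ)).toReal * M := by
  have h1 := enorm_fkReal_le_L2 v L (ht₀.trans_le hτ) hg Y
  have h2 := h1.trans (mul_le_mul' (heatConst_antitone (N := N) ht₀ hτ) hg2)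
  have hfin : ((∏ _i : Fin N, ∏ _k : Fin 3,
      ENNReal.ofReal (Real.sqrt (2 * Real.pi * (2 * t₀.toNNReal)))⁻¹) ^ (1 / 2 : ℝ)) ≠ ⊤ := by
    refine ENNReal.rpow_ne_top_of_nonneg (by norm_num) (ne_of_lt ?_)
    exact ENNReal.prod_lt_top fun i _ => ENNReal.prod_lt_top fun k _ => ENNReal.ofReal_lt_top
  calc |fkReal v L τ g Y| = (‖fkReal v L τ g Y‖ₑ).toReal := by
        rw [Real.enorm_eq_ofReal_abs, ENNReal.toReal_ofReal (abs_nonneg _)]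
    _ ≤ ((∏ _i : Fin N, ∏ _k : Fin 3,
          ENNReal.ofReal (Real.sqrt (2 * Real.pi * (2 * t₀.toNNReal)))⁻¹) ^ (1 / 2 : ℝ) *
            ENNReal.ofReal M).toReal :=
        ENNReal.toReal_mono (ENNReal.mul_ne_top hfin ENNReal.ofReal_ne_top) h2
    _ = _ := by rw [ENNReal.toReal_mul, ENNReal.toReal_ofReal hM]

/-- **Killing/interaction defect of the functional against the free expectation**: for a bounded
measurable `h` (`|h| ≤ K`), `s ≥ 0` and a bounded pair potential `v ≤ C`,
`|(e^{-sH} h)(X) - E[h(X + √2 b_s)]| ≤ K (P_X(τ ≤ s) + N² C s)`. [folklore] -/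
theorem abs_fkReal_sub_integral_worldLine_le {v : ℝ → ℝ≥0∞} {C : ℝ≥0} (hC : ∀ r, v r ≤ C)
    (hv : Measurable v) (L : ℝ) {s : ℝ} (hs : 0 ≤ s) {h : Config N → ℝ} (hh : Measurable h)
    {K : ℝ} (hK : ∀ Y, |h Y| ≤ K) (X : Config N) :
    |fkReal v L s h X - ∫ ω, h (worldLine X ω s.toNNReal) ∂wienerPaths N| ≤
      K * ((wienerPaths N (survives L s X)ᶜ).toReal + (N * N : ℕ) * C * s) := by
  have hK0 : 0 ≤ K := (abs_nonneg _).trans (hK 0)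
  -- integrability of the two bounded integrands
  have hwm : Measurable fun ω : PathSpace N => (fkWeight v L s X ω).toReal :=
    (measurable_fkWeight hv L s X).ennreal_toReal
  have hhm : Measurable fun ω : PathSpace N => h (worldLine X ω s.toNNReal) :=
    hh.comp (measurable_worldLine X _)
  have hi1 : Integrable (fun ω : PathSpace N =>
      (fkWeight v L s X ω).toReal * h (worldLine X ω s.toNNReal)) (wienerPaths N) := by
    refine (integrable_const K).mono' (hwm.mul hhm).aestronglyMeasurable
      (Eventually.of_forall fun ω => ?_)
    rw [Real.norm_eq_abs, abs_mul, abs_of_nonneg ENNReal.toReal_nonneg]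
    have hw1 : (fkWeight v L s X ω).toReal ≤ 1 := by
      simpa using ENNReal.toReal_mono ENNReal.one_ne_top (fkWeight_le_one v L s X ω)
    calc (fkWeight v L s X ω).toReal * |h (worldLine X ω s.toNNReal)| ≤ 1 * K :=
          mul_le_mul hw1 (hK _) (abs_nonneg _) zero_le_one
      _ = K := one_mul K
  have hi2 : Integrable (fun ω : PathSpace N => h (worldLine X ω s.toNNReal)) (wienerPaths N) :=
    (integrable_const K).mono' hhm.aestronglyMeasurable
      (Eventually.of_forall fun ω => by rw [Real.norm_eq_abs]; exact hK _)
  rw [fkReal, ← integral_sub hi1 hi2]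
  calc |∫ ω, ((fkWeight v L s X ω).toReal * h (worldLine X ω s.toNNReal) -
        h (worldLine X ω s.toNNReal)) ∂wienerPaths N|
      ≤ ∫ ω, |(fkWeight v L s X ω).toReal * h (worldLine X ω s.toNNReal) -
        h (worldLine X ω s.toNNReal)| ∂wienerPaths N := abs_integral_le_integral_abs
    _ ≤ ∫ ω, K * (1 - (fkWeight v L s X ω).toReal) ∂wienerPaths N := by
        have hwi : Integrable (fun ω : PathSpace N => (fkWeight v L s X ω).toReal) (wienerPaths N) :=
          (integrable_const (1 : ℝ)).mono' hwm.aestronglyMeasurable (Eventually.of_forall fun ω => by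
            rw [Real.norm_eq_abs, abs_of_nonneg ENNReal.toReal_nonneg]
            simpa using ENNReal.toReal_mono ENNReal.one_ne_top (fkWeight_le_one v L s X ω))
        have hint : Integrable (fun ω : PathSpace N => K * (1 - (fkWeight v L s X ω).toReal))
            (wienerPaths N) := ((integrable_const (1 : ℝ)).sub hwi).const_mul K
        refine integral_mono_of_nonneg (Eventually.of_forall fun ω => abs_nonneg _) hint
          (Eventually.of_forall fun ω => ?_)
        · dsimp only
          have hw1 : (fkWeight v L s X ω).toReal ≤ 1 := by
            simpa using ENNReal.toReal_mono ENNReal.one_ne_top (fkWeight_le_one v L s X ω)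
          rw [show (fkWeight v L s X ω).toReal * h (worldLine X ω s.toNNReal) -
              h (worldLine X ω s.toNNReal) =
              -((1 - (fkWeight v L s X ω).toReal) * h (worldLine X ω s.toNNReal)) by ring,
            abs_neg, abs_mul, abs_of_nonneg (sub_nonneg.2 hw1), mul_comm]
          exact mul_le_mul_of_nonneg_right (hK _) (sub_nonneg.2 hw1)
    _ = K * ∫ ω, (1 - (fkWeight v L s X ω).toReal) ∂wienerPaths N := integral_const_mul _ _
    _ ≤ K * ((wienerPaths N (survives L s X)ᶜ).toReal + (N * N : ℕ) * C * s) :=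
        mul_le_mul_of_nonneg_left (integral_one_sub_fkWeight_le hC L hs X) hK0

/-- **Choice of the small intermediate time**: the killing/interaction defect bound
`K (3N · P(∃ u ≤ s, a ≤ |b_u|) + N² C s)` is `≤ ε` for some `s ∈ (0, t/2]`. [folklore] -/
theorem exists_small_time (N : ℕ) (C : ℝ≥0) {t a ε : ℝ} (K : ℝ) (ht : 0 < t) (ha : 0 < a)
    (hε : 0 < ε) :
    ∃ s : ℝ≥0, 0 < (s : ℝ) ∧ (s : ℝ) ≤ t / 2 ∧
      K * ((∑ _i : Fin N, ∑ _k : Fin 3, preWienerMeasure {η | ∃ u ≤ s, a ≤ |brownian u η|}).toReal +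
        (N * N : ℕ) * C * s) ≤ ε := by
  haveI := Literature.Probability.RandomPlanarGeometry.isProbabilityMeasure_preWienerMeasure'
  -- the bound tends to `0` as `s → 0`
  have h1 : Tendsto (fun s : ℝ≥0 => (∑ _i : Fin N, ∑ _k : Fin 3,
      preWienerMeasure {η | ∃ u ≤ s, a ≤ |brownian u η|}).toReal) (𝓝 0) (𝓝 0) := by
    have hsum : Tendsto (fun s : ℝ≥0 => ∑ _i : Fin N, ∑ _k : Fin 3,
        preWienerMeasure {η | ∃ u ≤ s, a ≤ |brownian u η|}) (𝓝 0) (𝓝 0) := by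
      have := tendsto_finsetSum (Finset.univ : Finset (Fin N)) fun (i : Fin N) _ =>
        tendsto_finsetSum (Finset.univ : Finset (Fin 3)) fun (k : Fin 3) _ => tendsto_tail_zero ha
      simp only [Finset.sum_const_zero] at this
      exact this
    have := (ENNReal.tendsto_toReal ENNReal.zero_ne_top).comp hsum
    rw [ENNReal.toReal_zero] at this
    exact this
  have h2 : Tendsto (fun s : ℝ≥0 => K * ((∑ _i : Fin N, ∑ _k : Fin 3,
      preWienerMeasure {η | ∃ u ≤ s, a ≤ |brownian u η|}).toReal + (N * N : ℕ) * C * s))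
      (𝓝 0) (𝓝 0) := by
    have h3 : Tendsto (fun s : ℝ≥0 => (N * N : ℕ) * (C : ℝ) * s) (𝓝 0) (𝓝 0) := by
      have := (NNReal.continuous_coe.tendsto (0 : ℝ≥0)).const_mul ((N * N : ℕ) * (C : ℝ))
      simpa using this
    have := (h1.add h3).const_mul K
    simpa using this
  have hev : ∀ᶠ s : ℝ≥0 in 𝓝 0, K * ((∑ _i : Fin N, ∑ _k : Fin 3,
      preWienerMeasure {η | ∃ u ≤ s, a ≤ |brownian u η|}).toReal + (N * N : ℕ) * C * s) ≤ ε :=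
    h2.eventually (Iic_mem_nhds hε)
  have hev2 : ∀ᶠ s : ℝ≥0 in 𝓝 0, (s : ℝ) ≤ t / 2 :=
    (NNReal.continuous_coe.tendsto (0 : ℝ≥0)).eventually (Iic_mem_nhds (by simpa using half_pos ht))
  obtain ⟨s, ⟨hs1, hs2⟩, hs0⟩ := (((hev.and hev2).filter_mono nhdsWithin_le_nhds).and
    (eventually_mem_nhdsWithin (a := (0 : ℝ≥0)) (s := Set.Ioi 0))).exists
  exact ⟨s, by exact_mod_cast hs0, hs2, hs1⟩

/-- **Choice of the spatial modulus**: translation continuity of the heat kernel at time `s > 0`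
in `ε`-`δ` form. [folklore] -/
theorem exists_delta_heatKernel (N : ℕ) {s : ℝ≥0} (hs : s ≠ 0) {η : ℝ} (hη : 0 < η) :
    ∃ δ > 0, ∀ Z : Config N, ‖Z‖ < δ → ∫ Y : Config N,
      |(∏ i, ∏ k, gaussianPDFReal ((0 : Config N) i k) (2 * s) (Y i k)) -
        ∏ i, ∏ k, gaussianPDFReal (Z i k) (2 * s) (Y i k)| ≤ η := by
  have h := Metric.tendsto_nhds_nhds.1 (tendsto_integral_abs_heatKernel_sub (N := N) hs) η hη
  obtain ⟨δ, hδ, hZ⟩ := h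
  refine ⟨δ, hδ, fun Z hZδ => ?_⟩
  have := hZ (by simpa [dist_zero_right] using hZδ)
  rw [Real.dist_0_eq_abs, abs_of_nonneg (integral_nonneg fun Y => abs_nonneg _)] at this
  exact this.le

/-- **Interior equicontinuity of `e^{-tH_N}` on `L²(Λ)`-bounded sets** (the heart of the strong
Feller property and of compactness): for a bounded measurable pair potential, `t > 0`, `X₀` in the
open box, `M ≥ 0` and `ε > 0` there is `δ > 0` such that
`|(e^{-tH} g)(X) - (e^{-tH} g)(X')| ≤ ε` whenever `X, X' ∈ B(X₀, δ)` and `‖g‖_{L²(Λ)} ≤ M`.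
Chung–Zhao (1995), Thm 3.17 (strong Feller property of `T_t`; `T_t : L² → C_b(D)`).
[cite: ChungZhao1995, Thm 3.17] -/
theorem fkReal_equicontinuous {v : ℝ → ℝ≥0∞} (hv : Measurable v) {C : ℝ≥0} (hC : ∀ r, v r ≤ C)
    (L : ℝ) {t : ℝ} (ht : 0 < t) {X₀ : Config N} (hX₀ : X₀ ∈ boxN N L) {M : ℝ} (hM : 0 ≤ M)
    {ε : ℝ} (hε : 0 < ε) :
    ∃ δ > 0, ∀ X X' : Config N, dist X X₀ < δ → dist X' X₀ < δ →
      ∀ g : Config N → ℝ, Measurable g →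
        (∫⁻ Y in boxN N L, ‖g Y‖ₑ ^ (2 : ℝ)) ^ (1 / 2 : ℝ) ≤ ENNReal.ofReal M →
          |fkReal v L t g X - fkReal v L t g X'| ≤ ε := by
  -- an interior radius
  obtain ⟨R, hR, hball⟩ := Metric.isOpen_iff.1 (isOpen_boxN N L) X₀ hX₀
  set r : ℝ := R / 3 with hr
  have hr0 : 0 < r := by positivity
  have hclosed : ∀ X : Config N, dist X X₀ < r → Metric.closedBall X r ⊆ boxN N L := by
    intro X hX Y hY
    refine hball (Metric.mem_ball.2 ?_)
    calc dist Y X₀ ≤ dist Y X + dist X X₀ := dist_triangle _ _ _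
      _ < r + r := add_lt_add_of_le_of_lt (Metric.mem_closedBall.1 hY) hX
      _ ≤ R := by rw [hr]; linarith
  -- the uniform sup bound `K` on `h = e^{-(t-s)H} g` for `s ≤ t/2`
  set K : ℝ := ((∏ _i : Fin N, ∏ _k : Fin 3,
      ENNReal.ofReal (Real.sqrt (2 * Real.pi * (2 * (t / 2).toNNReal)))⁻¹) ^ (1 / 2 : ℝ)).toReal * M
    with hK
  have hK0 : 0 ≤ K := mul_nonneg ENNReal.toReal_nonneg hM
  -- the small time `s`
  obtain ⟨s, hs0, hst, hsε⟩ := exists_small_time N C (a := r / Real.sqrt 6) K ht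
    (by positivity) (show 0 < ε / 4 by positivity)
  have hs0' : (s : ℝ≥0) ≠ 0 := fun h => by simp [h] at hs0
  have hts : 0 < t - s := by linarith
  -- the spatial modulus at time `s`
  obtain ⟨δ₁, hδ₁, hmod⟩ := exists_delta_heatKernel N hs0' (show 0 < ε / (4 * (K + 1)) by positivity)
  refine ⟨min r (δ₁ / 2), lt_min hr0 (half_pos hδ₁), fun X X' hX hX' g hg hg2 => ?_⟩
  have hXr : dist X X₀ < r := hX.trans_le (min_le_left _ _)
  have hX'r : dist X' X₀ < r := hX'.trans_le (min_le_left _ _)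
  have hXX' : ‖X' - X‖ < δ₁ := by
    rw [← dist_eq_norm]
    calc dist X' X ≤ dist X' X₀ + dist X X₀ := dist_triangle_right _ _ _
      _ < δ₁ / 2 + δ₁ / 2 := add_lt_add (hX'.trans_le (min_le_right _ _)) (hX.trans_le (min_le_right _ _))
      _ = δ₁ := add_halves δ₁
  -- `h = e^{-(t-s)H} g`, bounded by `K`
  set h : Config N → ℝ := fkReal v L (t - s) g with hh
  have hhm : Measurable h := measurable_fkReal hv L _ hg
  have hhK : ∀ Y, |h Y| ≤ K := fun Y =>
    abs_fkReal_le_heatConst v L (half_pos ht) (by linarith) hg hM hg2 Y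
  -- the semigroup law `e^{-tH} g = e^{-sH} h`
  have hg2' : ∫⁻ Y in boxN N L, ‖g Y‖ₑ ^ (2 : ℝ) ≠ ⊤ := by
    intro htop
    rw [htop, ENNReal.top_rpow_of_pos (by norm_num)] at hg2
    exact ENNReal.ofReal_ne_top (top_le_iff.1 hg2)
  have hsemi : ∀ Y, fkReal v L t g Y = fkReal v L s h Y := by
    intro Y
    have := fkReal_add_time hv L hs0 hts hg hg2' Y
    rwa [add_sub_cancel] at this
  -- the killing/interaction defect at `X` and `X'`
  haveI := Literature.Probability.RandomPlanarGeometry.isProbabilityMeasure_preWienerMeasure'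
  have hfree : ∀ Y : Config N, dist Y X₀ < r →
      |fkReal v L s h Y - ∫ ω, h (worldLine Y ω s) ∂wienerPaths N| ≤ ε / 4 := by
    intro Y hY
    have h1 := abs_fkReal_sub_integral_worldLine_le hC hv L s.coe_nonneg hhm hhK Y
    simp only [Real.toNNReal_coe] at h1
    refine h1.trans ((mul_le_mul_of_nonneg_left (add_le_add ?_ le_rfl) hK0).trans hsε)
    refine ENNReal.toReal_mono (ne_of_lt ?_) (measure_not_survives_le L s hr0 (hclosed Y hY))
    refine (ENNReal.sum_lt_top.2 fun i _ => ENNReal.sum_lt_top.2 fun k _ => ?_)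
    exact measure_lt_top _ _
  -- the free part
  have hP : |(∫ ω, h (worldLine X ω s) ∂wienerPaths N) - ∫ ω, h (worldLine X' ω s) ∂wienerPaths N| ≤
      ε / 4 := by
    have h1 := abs_integral_worldLine_sub_le X X' hs0' hhm hhK
    rw [integral_abs_heatKernel_sub_eq X X' s] at h1
    have h2 := hmod (X' - X) hXX'
    have h3 : K / (K + 1) ≤ 1 := by rw [div_le_one (by linarith)]; linarith
    calc _ ≤ _ := h1
      _ ≤ K * (ε / (4 * (K + 1))) := mul_le_mul_of_nonneg_left h2 hK0
      _ = (K / (K + 1)) * (ε / 4) := by field_simp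
      _ ≤ 1 * (ε / 4) := mul_le_mul_of_nonneg_right h3 (by positivity)
      _ = ε / 4 := one_mul _
  calc |fkReal v L t g X - fkReal v L t g X'|
      = |fkReal v L s h X - fkReal v L s h X'| := by rw [hsemi X, hsemi X']
    _ ≤ |fkReal v L s h X - ∫ ω, h (worldLine X ω s) ∂wienerPaths N| +
        |(∫ ω, h (worldLine X ω s) ∂wienerPaths N) - ∫ ω, h (worldLine X' ω s) ∂wienerPaths N| +
        |(∫ ω, h (worldLine X' ω s) ∂wienerPaths N) - fkReal v L s h X'| :=
        (abs_sub_le _ _ _).trans (add_le_add (abs_sub_le _ _ _) le_rfl)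
    _ ≤ ε / 4 + ε / 4 + ε / 4 := by
        refine add_le_add (add_le_add (hfree X hXr) hP) ?_
        rw [abs_sub_comm]
        exact hfree X' hX'r
    _ ≤ ε := by linarith

/-! ### Strong Feller property -/

/-- **Strong Feller property of `e^{-tH_N}`**: for `t > 0` and `g` measurable and square
integrable on the box, `X ↦ (e^{-tH} g)(X)` is continuous at every point of the open box.
Chung–Zhao (1995), Thm 3.17. [cite: ChungZhao1995, Thm 3.17] -/
theorem continuousAt_fkReal {v : ℝ → ℝ≥0∞} (hv : Measurable v) {C : ℝ≥0} (hC : ∀ r, v r ≤ C)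
    (L : ℝ) {t : ℝ} (ht : 0 < t) {g : Config N → ℝ} (hg : Measurable g)
    (hg2 : ∫⁻ Y in boxN N L, ‖g Y‖ₑ ^ (2 : ℝ) ≠ ⊤) {X₀ : Config N} (hX₀ : X₀ ∈ boxN N L) :
    ContinuousAt (fkReal v L t g) X₀ := by
  rw [Metric.continuousAt_iff]
  intro ε hε
  set M : ℝ := ((∫⁻ Y in boxN N L, ‖g Y‖ₑ ^ (2 : ℝ)) ^ (1 / 2 : ℝ)).toReal with hM
  have hM0 : 0 ≤ M := ENNReal.toReal_nonneg
  have hgM : (∫⁻ Y in boxN N L, ‖g Y‖ₑ ^ (2 : ℝ)) ^ (1 / 2 : ℝ) ≤ ENNReal.ofReal M := by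
    rw [hM, ENNReal.ofReal_toReal (ENNReal.rpow_ne_top_of_nonneg (by norm_num) hg2)]
  obtain ⟨δ, hδ, hεδ⟩ := fkReal_equicontinuous hv hC L ht hX₀ hM0 (half_pos hε)
  refine ⟨δ, hδ, fun X hX => ?_⟩
  rw [Real.dist_eq]
  exact (hεδ X X₀ hX (by simpa using hδ) g hg hgM).trans_lt (half_lt_self hε)

/-- Continuity on the open box of `e^{-tH} g` for an `L²(Λ)` class `g`. [folklore] -/
theorem continuousOn_fkReal_coeFn {v : ℝ → ℝ≥0∞} (hv : Measurable v) {C : ℝ≥0} (hC : ∀ r, v r ≤ C)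
    (L : ℝ) {t : ℝ} (ht : 0 < t) (g : Lp ℝ 2 (volume.restrict (boxN N L))) :
    ContinuousOn (fkReal v L t g) (boxN N L) := fun _X hX =>
  (continuousAt_fkReal hv hC L ht (measurable_coeFn_Lp g) (setLIntegral_enorm_sq_ne_top g)
    hX).continuousWithinAt

/-! ### The kernel vector `u_t(X, ·) ∈ L²(Λ)` -/

/-- The `L²(Λ)` norm of a class is the square root of its box mass. [folklore] -/
theorem ofReal_norm_Lp {L : ℝ} (g : Lp ℝ 2 (volume.restrict (boxN N L))) :
    ENNReal.ofReal ‖g‖ = (∫⁻ Y in boxN N L, ‖g Y‖ₑ ^ (2 : ℝ)) ^ (1 / 2 : ℝ) := by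
  rw [Lp.norm_def, ← eLpNorm_two_eq, ENNReal.ofReal_toReal (Lp.eLpNorm_ne_top g)]

/-- **Equicontinuity read on the unit ball of `L²(Λ)`**: with `δ` from `fkReal_equicontinuous`
for `M = 1`, `|(e^{-tH} g)(X) - (e^{-tH} g)(X')| ≤ ε ‖g‖` for every class `g` (scaling).
[folklore] -/
theorem abs_fkReal_sub_le_mul_norm (v : ℝ → ℝ≥0∞) (L : ℝ) {t : ℝ} (ht : 0 < t)
    {ε : ℝ} {X X' : Config N}
    (h : ∀ g : Config N → ℝ, Measurable g →
      (∫⁻ Y in boxN N L, ‖g Y‖ₑ ^ (2 : ℝ)) ^ (1 / 2 : ℝ) ≤ ENNReal.ofReal 1 →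
        |fkReal v L t g X - fkReal v L t g X'| ≤ ε)
    (g : Lp ℝ 2 (volume.restrict (boxN N L))) :
    |fkReal v L t g X - fkReal v L t g X'| ≤ ε * ‖g‖ := by
  rcases eq_or_ne ‖g‖ 0 with h0 | h0
  · -- `g = 0`: both values vanish
    have hg0 : g = 0 := norm_eq_zero.1 h0
    have hae : (g : Config N → ℝ) =ᵐ[volume.restrict (boxN N L)] (0 : Config N → ℝ) := by
      rw [hg0]; exact Lp.coeFn_zero _ _ _
    rw [fkReal_congr_ae_restrict v L ht hae X, fkReal_congr_ae_restrict v L ht hae X', h0, mul_zero]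
    simp [fkReal]
  · have hpos : 0 < ‖g‖ := lt_of_le_of_ne (norm_nonneg _) (Ne.symm h0)
    -- the normalised representative `g' = ‖g‖⁻¹ g`
    set g' : Config N → ℝ := ‖g‖⁻¹ • (g : Config N → ℝ) with hg'
    have hg'm : Measurable g' := (measurable_coeFn_Lp g).const_smul _
    have hmass : (∫⁻ Y in boxN N L, ‖g' Y‖ₑ ^ (2 : ℝ)) ^ (1 / 2 : ℝ) ≤ ENNReal.ofReal 1 := by
      have hsm : ∀ Y, ‖g' Y‖ₑ ^ (2 : ℝ) = ENNReal.ofReal (‖g‖⁻¹) ^ (2 : ℝ) * ‖(g : Config N → ℝ) Y‖ₑ ^ (2 : ℝ) := by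
        intro Y
        rw [hg', Pi.smul_apply, smul_eq_mul, enorm_mul, ENNReal.mul_rpow_of_nonneg _ _ (by norm_num),
          Real.enorm_of_nonneg (inv_nonneg.2 (norm_nonneg _))]
      simp_rw [hsm]
      rw [lintegral_const_mul _ ((measurable_coeFn_Lp g).enorm.pow_const _),
        ENNReal.mul_rpow_of_nonneg _ _ (by norm_num), ← ENNReal.rpow_mul]
      have h21 : (2 : ℝ) * (1 / 2) = 1 := by norm_num
      rw [h21, ENNReal.rpow_one, ← ofReal_norm_Lp g, ← ENNReal.ofReal_mul (inv_nonneg.2 (norm_nonneg _)),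
        inv_mul_cancel₀ h0]
    have key := h g' hg'm hmass
    have hsc : ∀ Y, fkReal v L t g' Y = ‖g‖⁻¹ * fkReal v L t g Y := fun Y => fkReal_smul v L t _ _ Y
    rw [hsc, hsc, ← mul_sub, abs_mul, abs_of_pos (inv_pos.2 hpos)] at key
    rwa [inv_mul_le_iff₀ hpos, mul_comm] at key

/-- **The kernel vector `κ_t(X) ∈ L²(Λ)` depends continuously on `X` inside the box**: the Riesz
vector of the evaluation functional `g ↦ (e^{-tH} g)(X)` (`fkEval v L t X`), i.e. the function
`u_t(X, ·)`, is continuous on the open box as an `L²(Λ)`-valued map (equicontinuity on the unit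
ball). Chung–Zhao (1995), Thm 3.17 (`u_t ∈ C_b(D × D)`). [cite: ChungZhao1995, Thm 3.17] -/
theorem continuousOn_fkKernelVec {v : ℝ → ℝ≥0∞} (hv : Measurable v) {C : ℝ≥0} (hC : ∀ r, v r ≤ C)
    (L : ℝ) {t : ℝ} (ht : 0 < t) :
    ContinuousOn (fun X : Config N => (InnerProductSpace.toDual ℝ (Lp ℝ 2 (volume.restrict (boxN N L)))).symm
      (fkEval v L t X)) (boxN N L) := by
  intro X₀ hX₀
  rw [Metric.continuousWithinAt_iff]
  intro ε hε
  obtain ⟨δ, hδ, hεδ⟩ := fkReal_equicontinuous hv hC L ht hX₀ zero_le_one (half_pos hε)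
  refine ⟨δ, hδ, fun X _ hX => ?_⟩
  rw [dist_eq_norm, ← LinearIsometryEquiv.map_sub, LinearIsometryEquiv.norm_map]
  refine lt_of_le_of_lt (ContinuousLinearMap.opNorm_le_bound _ (half_pos hε).le fun g => ?_)
    (half_lt_self hε)
  rw [FunLike.coe_sub, Pi.sub_apply, fkEval_apply hv L ht, fkEval_apply hv L ht, Real.norm_eq_abs]
  exact abs_fkReal_sub_le_mul_norm v L ht (fun g hg hg1 => hεδ X X₀ hX (by simpa using hδ) g hg hg1) g

/-- The kernel vector represents the operator: `⟪κ_t(X), g⟫ = (e^{-tH} g)(X)`. [folklore] -/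
theorem inner_fkKernelVec {v : ℝ → ℝ≥0∞} (hv : Measurable v) (L : ℝ) {t : ℝ} (ht : 0 < t)
    (X : Config N) (g : Lp ℝ 2 (volume.restrict (boxN N L))) :
    ⟪(InnerProductSpace.toDual ℝ (Lp ℝ 2 (volume.restrict (boxN N L)))).symm (fkEval v L t X), g⟫_ℝ =
      fkReal v L t g X := by
  rw [InnerProductSpace.toDual_symm_apply, fkEval_apply hv L ht]

/-! ### Compactness -/

/-- **Multiplication by the indicator of a measurable set is a bounded operator on `L²`**
(existence form: `P g = 𝟙_K g` a.e.). [folklore] -/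
theorem exists_indicator_clm {α : Type*} [MeasurableSpace α] (μ : Measure α) {K : Set α}
    (hK : MeasurableSet K) :
    ∃ P : Lp ℝ 2 μ →L[ℝ] Lp ℝ 2 μ, ∀ g : Lp ℝ 2 μ, (P g : α → ℝ) =ᵐ[μ] K.indicator g := by
  refine ⟨LinearMap.mkContinuous
    { toFun := fun g => ((Lp.memLp g).indicator hK).toLp (K.indicator g)
      map_add' := fun g g' => ?_
      map_smul' := fun c g => ?_ } 1 fun g => ?_, fun g => ?_⟩
  · rw [← MemLp.toLp_add]
    refine MemLp.toLp_congr _ _ ?_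
    filter_upwards [Lp.coeFn_add g g'] with x hx
    by_cases hxK : x ∈ K
    · simp only [Set.indicator_of_mem hxK, hx, Pi.add_apply]
    · simp only [Pi.add_apply, Set.indicator_of_notMem hxK, add_zero]
  · rw [RingHom.id_apply, ← MemLp.toLp_const_smul]
    refine MemLp.toLp_congr _ _ ?_
    filter_upwards [Lp.coeFn_smul c g] with x hx
    by_cases hxK : x ∈ K
    · simp only [Set.indicator_of_mem hxK, hx, Pi.smul_apply, smul_eq_mul]
    · simp only [Pi.smul_apply, smul_eq_mul, Set.indicator_of_notMem hxK, mul_zero]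
  · simp only [LinearMap.coe_mk, AddHom.coe_mk, Lp.norm_toLp, one_mul]
    rw [Lp.norm_def]
    exact ENNReal.toReal_mono (Lp.eLpNorm_ne_top g) (eLpNorm_indicator_le _)
  · simp only [LinearMap.mkContinuous_apply, LinearMap.coe_mk, AddHom.coe_mk]
    exact MemLp.coeFn_toLp _

/-- **The truncation `𝟙_K e^{-tH}` to a compact `K ⊂ Λ` is a compact operator** (the tree's
criterion `isCompactOperator_of_ae_eq_indicator_inner` with the continuous kernel vector).
[folklore] -/
theorem isCompactOperator_indicator_comp_fkL2 {v : ℝ → ℝ≥0∞} (hv : Measurable v) {C : ℝ≥0}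
    (hC : ∀ r, v r ≤ C) (L : ℝ) {t : ℝ} (ht : 0 < t) {K : Set (Config N)} (hKc : IsCompact K)
    (hKD : K ⊆ boxN N L) (P : Lp ℝ 2 (volume.restrict (boxN N L)) →L[ℝ] Lp ℝ 2 (volume.restrict (boxN N L)))
    (hP : ∀ g, (P g : Config N → ℝ) =ᵐ[volume.restrict (boxN N L)] K.indicator g) :
    IsCompactOperator (P.comp (fkL2 v L t)) := by
  haveI : IsFiniteMeasure (volume.restrict (boxN N L)) :=
    ⟨by rw [Measure.restrict_apply_univ]; exact volume_boxN_lt_top N L⟩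
  refine Literature.Analysis.FunctionSpaces.isCompactOperator_of_ae_eq_indicator_inner hKc
    (fun X => (InnerProductSpace.toDual ℝ (Lp ℝ 2 (volume.restrict (boxN N L)))).symm (fkEval v L t X))
    ((continuousOn_fkKernelVec hv hC L ht).mono hKD) (P.comp (fkL2 v L t)) fun g => ?_
  rw [ContinuousLinearMap.comp_apply]
  filter_upwards [hP (fkL2 v L t g), fkL2_coeFn hv L ht g,
    ae_restrict_mem (measurableSet_boxN N L)] with X h1 h2 _
  rw [h1]
  simp only [inner_fkKernelVec hv L ht]
  by_cases hXK : X ∈ K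
  · rw [Set.indicator_of_mem hXK, Set.indicator_of_mem hXK]
    exact h2
  · rw [Set.indicator_of_notMem hXK, Set.indicator_of_notMem hXK]

/-- The open box is bounded: `‖X‖ ≤ √3 |L|` for `X ∈ Λ_L^N`. [folklore] -/
theorem isBounded_boxN (N : ℕ) (L : ℝ) : Bornology.IsBounded (boxN N L) := by
  refine isBounded_iff_forall_norm_le.2 ⟨Real.sqrt 3 * |L|, fun X hX => ?_⟩
  refine (pi_norm_le_iff_of_nonneg (by positivity)).2 fun i => ?_
  rw [EuclideanSpace.norm_eq]
  have hk : ∀ k : Fin 3, ‖X i k‖ ^ 2 ≤ L ^ 2 := fun k => by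
    have h := (hX i) k
    rw [Real.norm_eq_abs, sq_abs]
    nlinarith [h.1, h.2]
  calc Real.sqrt (∑ k, ‖X i k‖ ^ 2) ≤ Real.sqrt (∑ _k : Fin 3, L ^ 2) :=
        Real.sqrt_le_sqrt (Finset.sum_le_sum fun k _ => hk k)
    _ = Real.sqrt 3 * |L| := by
        rw [Finset.sum_const, Finset.card_univ, Fintype.card_fin, nsmul_eq_mul, Nat.cast_ofNat,
          Real.sqrt_mul (by norm_num), Real.sqrt_sq_eq_abs]

/-- **The closed sub-boxes `K_n = {X | L/(n+2) ≤ X i k ≤ L - L/(n+2)}` exhaust the open box**: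
they are compact subsets of `Λ`, increase with `n`, and cover `Λ`. [folklore] -/
theorem subbox_props {L : ℝ} (hL : 0 < L) :
    (∀ n : ℕ, IsCompact {X : Config N | ∀ i k, X i k ∈ Set.Icc (L / (n + 2)) (L - L / (n + 2))}) ∧
    (∀ n : ℕ, {X : Config N | ∀ i k, X i k ∈ Set.Icc (L / (n + 2)) (L - L / (n + 2))} ⊆ boxN N L) ∧
    Monotone (fun n : ℕ => {X : Config N | ∀ i k, X i k ∈ Set.Icc (L / (n + 2)) (L - L / (n + 2))}) ∧
    (∀ X ∈ boxN N L, ∃ n : ℕ, X ∈ {X : Config N | ∀ i k, X i k ∈ Set.Icc (L / (n + 2)) (L - L / (n + 2))}) := by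
  have hpos : ∀ n : ℕ, 0 < L / (n + 2) := fun n => by positivity
  have hsub : ∀ n : ℕ, {X : Config N | ∀ i k, X i k ∈ Set.Icc (L / (n + 2)) (L - L / (n + 2))} ⊆
      boxN N L := fun n X hX i k =>
    ⟨(hpos n).trans_le (hX i k).1, (hX i k).2.trans_lt (by linarith [hpos n])⟩
  refine ⟨fun n => ?_, hsub, fun m n hmn X hX i k => ?_, fun X hX => ?_⟩
  · refine Metric.isCompact_of_isClosed_isBounded ?_ ((isBounded_boxN N L).subset (hsub n))
    have : {X : Config N | ∀ i k, X i k ∈ Set.Icc (L / (n + 2)) (L - L / (n + 2))} =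
        ⋂ i : Fin N, ⋂ k : Fin 3, (fun X : Config N => X i k) ⁻¹' Set.Icc (L / (n + 2)) (L - L / (n + 2)) := by
      ext X; simp
    rw [this]
    exact isClosed_iInter fun i => isClosed_iInter fun k =>
      isClosed_Icc.preimage ((PiLp.continuous_apply 2 _ k).comp (continuous_apply i))
  · have hmn' : L / ((n : ℝ) + 2) ≤ L / ((m : ℝ) + 2) :=
      div_le_div_of_nonneg_left hL.le (by positivity) (by exact_mod_cast Nat.add_le_add_right hmn 2)
    exact ⟨hmn'.trans (hX i k).1, (hX i k).2.trans (by linarith)⟩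
  · -- `L/(n+2) → 0`, and there are finitely many coordinates
    have hlim : Tendsto (fun n : ℕ => L / ((n : ℝ) + 2)) atTop (𝓝 0) := by
      have h1 : Tendsto (fun n : ℕ => (n : ℝ) + 2) atTop atTop :=
        tendsto_atTop_add_const_right _ _ tendsto_natCast_atTop_atTop
      exact tendsto_const_nhds.div_atTop h1
    have hev : ∀ i k, ∀ᶠ n : ℕ in atTop, X i k ∈ Set.Icc (L / (n + 2)) (L - L / (n + 2)) := by
      intro i k
      have h1 := (hX i) k
      filter_upwards [hlim.eventually_lt_const h1.1,
        hlim.eventually_lt_const (sub_pos.2 h1.2)] with n hn1 hn2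
      exact ⟨hn1.le, by linarith⟩
    obtain ⟨n, hn⟩ := (eventually_all.2 fun i => eventually_all.2 fun k => hev i k).exists
    exact ⟨n, fun i k => hn i k⟩

/-- **`e^{-tH_N}` is a compact operator on `L²(Λ_L^N)`** (`t > 0`, `L > 0`, bounded measurable
pair potential): norm limit of the compact truncations `𝟙_{K_n} e^{-tH}` along the exhaustion of
the open box by closed sub-boxes, since `‖e^{-tH} - 𝟙_{K_n} e^{-tH}‖ ≤ (4πt)^{-3N/4} |Λ ∖ K_n|^{1/2}`.
Chung–Zhao (1995), Thm 3.17 ("It is a compact operator in all the appropriate spaces" for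
`m(D) < ∞`). [cite: ChungZhao1995, Thm 3.17] -/
theorem isCompactOperator_fkL2 {v : ℝ → ℝ≥0∞} (hv : Measurable v) {C : ℝ≥0} (hC : ∀ r, v r ≤ C)
    {L : ℝ} (hL : 0 < L) {t : ℝ} (ht : 0 < t) :
    IsCompactOperator (fkL2 v L t :
      Lp ℝ 2 (volume.restrict (boxN N L)) →L[ℝ] Lp ℝ 2 (volume.restrict (boxN N L))) := by
  set μ : Measure (Config N) := volume.restrict (boxN N L) with hμ
  haveI hfin : IsFiniteMeasure μ :=
    ⟨by rw [hμ, Measure.restrict_apply_univ]; exact volume_boxN_lt_top N L⟩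
  set T : Lp ℝ 2 μ →L[ℝ] Lp ℝ 2 μ := fkL2 v L t with hT
  obtain ⟨hKc, hKD, hKmono, hKcover⟩ := subbox_props (N := N) hL
  set K : ℕ → Set (Config N) := fun n =>
    {X : Config N | ∀ i k, X i k ∈ Set.Icc (L / (n + 2)) (L - L / (n + 2))} with hK
  have hKm : ∀ n, MeasurableSet (K n) := fun n => (hKc n).isClosed.measurableSet
  -- the truncations
  choose P hP using fun n => exists_indicator_clm μ (hKm n)
  have hPc : ∀ n, IsCompactOperator ((P n).comp T) := fun n =>
    isCompactOperator_indicator_comp_fkL2 hv hC L ht (hKc n) (hKD n) (P n) (hP n)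
  -- `μ (K n)ᶜ → 0`
  have hμK : Tendsto (fun n => μ (K n)ᶜ) atTop (𝓝 0) := by
    have h1 : Tendsto (fun n => μ (K n)) atTop (𝓝 (μ (⋃ n, K n))) := tendsto_measure_iUnion_atTop hKmono
    have hU : μ (⋃ n, K n) = μ Set.univ := by
      have hUeq : (⋃ n, K n) ∩ boxN N L = boxN N L := by
        refine Set.ext fun X => ⟨fun h => h.2, fun hX => ⟨?_, hX⟩⟩
        obtain ⟨n, hn⟩ := hKcover X hX
        exact Set.mem_iUnion.2 ⟨n, hn⟩
      rw [hμ, Measure.restrict_apply_univ, Measure.restrict_apply (MeasurableSet.iUnion hKm), hUeq]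
    rw [hU] at h1
    have h2 : ∀ n, μ (K n)ᶜ = μ Set.univ - μ (K n) := fun n => measure_compl (hKm n) (measure_ne_top _ _)
    simp_rw [h2]
    have := ENNReal.Tendsto.sub (tendsto_const_nhds (x := μ Set.univ)) h1 (Or.inl (measure_ne_top _ _))
    rwa [tsub_self] at this
  -- the norm estimate
  set Cst : ℝ≥0∞ := (∏ _i : Fin N, ∏ _k : Fin 3,
    ENNReal.ofReal (Real.sqrt (2 * Real.pi * (2 * t.toNNReal)))⁻¹) ^ (1 / 2 : ℝ) with hCst
  have hCfin : Cst ≠ ⊤ := by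
    refine ENNReal.rpow_ne_top_of_nonneg (by norm_num) (ne_of_lt ?_)
    exact ENNReal.prod_lt_top fun i _ => ENNReal.prod_lt_top fun k _ => ENNReal.ofReal_lt_top
  have hnorm : ∀ n, ‖T - (P n).comp T‖ ≤ ((μ (K n)ᶜ) ^ (1 / 2 : ℝ)).toReal * Cst.toReal := by
    intro n
    refine ContinuousLinearMap.opNorm_le_bound _ (by positivity) fun g => ?_
    -- the a.e. pointwise bound on `T g`
    have hpt : ∀ᵐ X ∂μ, ‖(T g : Config N → ℝ) X‖ ≤ Cst.toReal * ‖g‖ := by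
      filter_upwards [fkL2_coeFn hv L ht g] with X hX
      rw [hX]
      calc ‖fkReal v L t g X‖ = (‖fkReal v L t g X‖ₑ).toReal := by
            rw [Real.enorm_eq_ofReal_abs, ENNReal.toReal_ofReal (abs_nonneg _), Real.norm_eq_abs]
        _ ≤ (Cst * ENNReal.ofReal ‖g‖).toReal := by
            refine ENNReal.toReal_mono (ENNReal.mul_ne_top hCfin ENNReal.ofReal_ne_top) ?_
            rw [ofReal_norm_Lp g]
            exact enorm_fkReal_le_L2 v L ht (measurable_coeFn_Lp g) X
        _ = Cst.toReal * ‖g‖ := by rw [ENNReal.toReal_mul, ENNReal.toReal_ofReal (norm_nonneg _)]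
    -- the representative of `(T - P n T) g` is `𝟙_{K_nᶜ} (T g)`
    have hrep : ((T - (P n).comp T) g : Config N → ℝ) =ᵐ[μ] (K n)ᶜ.indicator (T g : Config N → ℝ) := by
      rw [show (T - (P n).comp T) g = T g - (P n) (T g) from rfl]
      filter_upwards [Lp.coeFn_sub (T g) ((P n) (T g)), hP n (T g)] with X h1 h2
      rw [h1, Pi.sub_apply, h2, Set.indicator_compl, Pi.sub_apply]
    rw [Lp.norm_def, eLpNorm_congr_ae hrep, eLpNorm_indicator_eq_eLpNorm_restrict (hKm n).compl]
    have hb := eLpNorm_le_of_ae_bound (p := 2) (μ := μ.restrict (K n)ᶜ)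
      (ae_restrict_of_ae hpt : ∀ᵐ X ∂μ.restrict (K n)ᶜ, ‖(T g : Config N → ℝ) X‖ ≤ Cst.toReal * ‖g‖)
    rw [Measure.restrict_apply_univ] at hb
    have h2 : (2 : ℝ≥0∞).toReal⁻¹ = (1 / 2 : ℝ) := by norm_num
    rw [h2] at hb
    calc (eLpNorm (T g : Config N → ℝ) 2 (μ.restrict (K n)ᶜ)).toReal
        ≤ ((μ (K n)ᶜ) ^ (1 / 2 : ℝ) * ENNReal.ofReal (Cst.toReal * ‖g‖)).toReal :=
          ENNReal.toReal_mono (ENNReal.mul_ne_top (ENNReal.rpow_ne_top_of_nonneg (by norm_num)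
            (measure_ne_top _ _)) ENNReal.ofReal_ne_top) hb
      _ = ((μ (K n)ᶜ) ^ (1 / 2 : ℝ)).toReal * Cst.toReal * ‖g‖ := by
          rw [ENNReal.toReal_mul, ENNReal.toReal_ofReal (by positivity), mul_assoc]
  -- convergence in operator norm and conclusion
  have hlim : Tendsto (fun n => (P n).comp T) atTop (𝓝 T) := by
    rw [tendsto_iff_norm_sub_tendsto_zero]
    have h0 : Tendsto (fun n => ((μ (K n)ᶜ) ^ (1 / 2 : ℝ)).toReal * Cst.toReal) atTop (𝓝 0) := by
      have h1 : Tendsto (fun n => (μ (K n)ᶜ) ^ (1 / 2 : ℝ)) atTop (𝓝 0) := by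
        have := (ENNReal.continuous_rpow_const (y := (1 / 2 : ℝ))).tendsto 0 |>.comp hμK
        rw [ENNReal.zero_rpow_of_pos (by norm_num : (0 : ℝ) < 1 / 2)] at this
        exact this
      have h2 := (ENNReal.tendsto_toReal ENNReal.zero_ne_top).comp h1
      rw [ENNReal.toReal_zero] at h2
      simpa using h2.mul_const Cst.toReal
    refine squeeze_zero (fun n => norm_nonneg _) (fun n => ?_) h0
    rw [norm_sub_rev]
    exact hnorm n
  exact isCompactOperator_of_tendsto hlim (Eventually.of_forall hPc)

end Literature.MathematicalPhysics.QuantumManyBody.BoseGas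

end
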